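import Mathlib.Analysis.Calculus.MeanValue
import Mathlib.Analysis.SpecialFunctions.Exp
import HarnessLib

/-!
# Localised DISPLACEMENT rows from localised DERIVATIVE rows (mean-value bookkeeping for a two-parameter family of configurations)

Topic `Literature/Analysis/Matrix`; namespace `Literature.Analysis.Matrix`.  Bridge between `LocalisedResponse.lean` ∕
`LogDetMixedDifferenceExpLocalised.lean` (whose conclusions are bounds on DERIVATIVES of a responding background: first order
`|∂U k| ≤ δ·e^{−θ·d k}` — `abs_response_le_of_row_expLocalised`, `exists_branch_localisedResponse` — and mixed
`|∂_σ∂_τU k| ≤ μ·e^{−θ(d k + d′ k)}` — `abs_mixedResponse_le`) and `TraceInvMulMixedDifferenceLocalMaps.lean` ∕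
`TraceInvMulMixedDifferenceOfFloor.lean` (whose hypotheses are the five finite DISPLACEMENT rows of the four corner configurations
`U₀₀ = U(0,0), U₁₀ = U(s,0), U₀₁ = U(0,t), U₁₁ = U(s,t)`).  Everything here is PROVED; no definitions, no named facts; one-dimensional
mean-value inequality per coordinate (Mathlib `norm_image_sub_le_of_norm_deriv_le_segment'`).

* `abs_sub_le_of_abs_deriv_le` — `|f s − f 0| ≤ C·s` from `|f′| ≤ C` on `[0,s]`.
* ★`displacement_rows_of_deriv` — for `U : ℝ → ℝ → (n → ℝ)` with partial derivatives `Uσ, Uτ` and the mixed derivative `Uστ = ∂_σUτ` on the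
  rectangle `[0,s]×[0,t]`, localised as `|Uσ| ≤ δ·e^{−θd}`, `|Uτ| ≤ δ′·e^{−θd′}`, `|Uστ| ≤ μ·e^{−θ(d+d′)}`:
  `|U(s,0) − U(0,0)|, |U(s,t) − U(0,t)| ≤ δ·s·e^{−θd}`; `|U(0,t) − U(0,0)|, |U(s,t) − U(s,0)| ≤ δ′·t·e^{−θd′}`;
  `|U(s,t) − U(s,0) − U(0,t) + U(0,0)| ≤ μ·s·t·e^{−θ(d+d′)}` — coordinate by coordinate.

Consumer: cell `ym3-torus`, crux `FluctuationComparisonRegPrIntL`, DISCHARGE-SPEC v1.8 §11 (xv) (the one-loop trace rectangle: the background at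
the four corners of a coarse two-bond square, [Balaban1985Variational] Thm 1 (10) p. 279).  HONEST SCOPE: calculus bookkeeping; nothing here bears
on the Yang–Mills mass gap (Clay), which is NOT proved.

References: W. Rudin, *Principles of Mathematical Analysis* (1976) Thm 5.19 (mean-value inequality) [Rudin1976]; T. Bałaban, CMP 102 (1985) 277,
Thm 1 (10) p. 279 [Balaban1985Variational].
-/

noncomputable section

open Set

namespace Literature.Analysis.Matrix

/-- **Mean-value inequality on `[0,s]`, real-valued**: if `f` has derivative `f′ σ` at every `σ ∈ [0,s]` (`s ≥ 0`) and `|f′ σ| ≤ C` there,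
then `|f s − f 0| ≤ C·s`. [cite: Rudin1976, Thm 5.19] -/
theorem abs_sub_le_of_abs_deriv_le {f f' : ℝ → ℝ} {s C : ℝ} (hs : 0 ≤ s)
    (hf : ∀ σ ∈ Icc (0 : ℝ) s, HasDerivAt f (f' σ) σ) (hb : ∀ σ ∈ Icc (0 : ℝ) s, |f' σ| ≤ C) :
    |f s - f 0| ≤ C * s := by
  have h := norm_image_sub_le_of_norm_deriv_le_segment' (f := f) (f' := f') (a := 0) (b := s)
    (fun σ hσ => (hf σ hσ).hasDerivWithinAt)
    (fun σ hσ => by rw [Real.norm_eq_abs]; exact hb σ (Ico_subset_Icc_self hσ)) s (right_mem_Icc.2 hs)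
  rw [Real.norm_eq_abs, sub_zero] at h
  exact h

/-- ★ **THE FIVE LOCALISED DISPLACEMENT ROWS FROM LOCALISED DERIVATIVE ROWS.**  Let `U : ℝ → ℝ → (n → ℝ)` be a two-parameter family of
configurations on the rectangle `[0,s]×[0,t]` (`s, t ≥ 0`) with, for every coordinate `k`: `σ`-derivative `Uσ σ τ k`, `τ`-derivative `Uτ σ τ k`,
and mixed derivative `Uστ σ τ k` of `σ ↦ Uτ σ τ k`, at every point of the rectangle; localised along 1-parameter profiles `d, d′ : n → ℕ` as
`|Uσ σ τ k| ≤ δ·e^{−θ·d k}`, `|Uτ σ τ k| ≤ δ′·e^{−θ·d′ k}`, `|Uστ σ τ k| ≤ μ·e^{−θ·(d k + d′ k)}`.  Then the four corners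
`U(0,0), U(s,0), U(0,t), U(s,t)` satisfy the five displacement rows of `abs_fourPt_trace_inv_mul_le_of_localMaps`:
`|U(s,0) k − U(0,0) k| ≤ δ·s·e^{−θ·d k}`, `|U(s,t) k − U(0,t) k| ≤ δ·s·e^{−θ·d k}`, `|U(0,t) k − U(0,0) k| ≤ δ′·t·e^{−θ·d′ k}`,
`|U(s,t) k − U(s,0) k| ≤ δ′·t·e^{−θ·d′ k}`, `|U(s,t) k − U(s,0) k − U(0,t) k + U(0,0) k| ≤ μ·s·t·e^{−θ·(d k + d′ k)}`.
[cite: Balaban1985Variational, Thm 1 (10) p. 279] [cite: Rudin1976, Thm 5.19] -/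
theorem displacement_rows_of_deriv {n : Type*} {U Uσ Uτ Uστ : ℝ → ℝ → n → ℝ} {s t δ δ' μ θ : ℝ} {d d' : n → ℕ}
    (hs : 0 ≤ s) (ht : 0 ≤ t)
    (hUσ : ∀ σ ∈ Icc (0 : ℝ) s, ∀ τ ∈ Icc (0 : ℝ) t, ∀ k, HasDerivAt (fun σ => U σ τ k) (Uσ σ τ k) σ)
    (hUτ : ∀ σ ∈ Icc (0 : ℝ) s, ∀ τ ∈ Icc (0 : ℝ) t, ∀ k, HasDerivAt (fun τ => U σ τ k) (Uτ σ τ k) τ)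
    (hUστ : ∀ σ ∈ Icc (0 : ℝ) s, ∀ τ ∈ Icc (0 : ℝ) t, ∀ k, HasDerivAt (fun σ => Uτ σ τ k) (Uστ σ τ k) σ)
    (bσ : ∀ σ ∈ Icc (0 : ℝ) s, ∀ τ ∈ Icc (0 : ℝ) t, ∀ k, |Uσ σ τ k| ≤ δ * Real.exp (-(θ * d k)))
    (bτ : ∀ σ ∈ Icc (0 : ℝ) s, ∀ τ ∈ Icc (0 : ℝ) t, ∀ k, |Uτ σ τ k| ≤ δ' * Real.exp (-(θ * d' k)))
    (bστ : ∀ σ ∈ Icc (0 : ℝ) s, ∀ τ ∈ Icc (0 : ℝ) t, ∀ k, |Uστ σ τ k| ≤ μ * Real.exp (-(θ * (d k + d' k)))) :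
    (∀ k, |U s 0 k - U 0 0 k| ≤ δ * s * Real.exp (-(θ * d k))) ∧
    (∀ k, |U s t k - U 0 t k| ≤ δ * s * Real.exp (-(θ * d k))) ∧
    (∀ k, |U 0 t k - U 0 0 k| ≤ δ' * t * Real.exp (-(θ * d' k))) ∧
    (∀ k, |U s t k - U s 0 k| ≤ δ' * t * Real.exp (-(θ * d' k))) ∧
    (∀ k, |U s t k - U s 0 k - U 0 t k + U 0 0 k| ≤ μ * s * t * Real.exp (-(θ * (d k + d' k)))) := by
  have h0s : (0 : ℝ) ∈ Icc (0 : ℝ) s := left_mem_Icc.2 hs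
  have h0t : (0 : ℝ) ∈ Icc (0 : ℝ) t := left_mem_Icc.2 ht
  have hss : s ∈ Icc (0 : ℝ) s := right_mem_Icc.2 hs
  have htt : t ∈ Icc (0 : ℝ) t := right_mem_Icc.2 ht
  -- σ-moves at fixed τ ∈ {0, t}
  have rowσ : ∀ τ ∈ Icc (0 : ℝ) t, ∀ k, |U s τ k - U 0 τ k| ≤ δ * s * Real.exp (-(θ * d k)) := by
    intro τ hτ k
    have h := abs_sub_le_of_abs_deriv_le (f := fun σ => U σ τ k) (f' := fun σ => Uσ σ τ k) hs
      (fun σ hσ => hUσ σ hσ τ hτ k) (fun σ hσ => bσ σ hσ τ hτ k)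
    calc |U s τ k - U 0 τ k| ≤ δ * Real.exp (-(θ * d k)) * s := h
      _ = δ * s * Real.exp (-(θ * d k)) := by ring
  -- τ-moves at fixed σ ∈ {0, s}
  have rowτ : ∀ σ ∈ Icc (0 : ℝ) s, ∀ k, |U σ t k - U σ 0 k| ≤ δ' * t * Real.exp (-(θ * d' k)) := by
    intro σ hσ k
    have h := abs_sub_le_of_abs_deriv_le (f := fun τ => U σ τ k) (f' := fun τ => Uτ σ τ k) ht
      (fun τ hτ => hUτ σ hσ τ hτ k) (fun τ hτ => bτ σ hσ τ hτ k)
    calc |U σ t k - U σ 0 k| ≤ δ' * Real.exp (-(θ * d' k)) * t := h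
      _ = δ' * t * Real.exp (-(θ * d' k)) := by ring
  refine ⟨fun k => rowσ 0 h0t k, fun k => rowσ t htt k, fun k => rowτ 0 h0s k, fun k => rowτ s hss k, fun k => ?_⟩
  -- the mixed row: `g τ := U s τ k − U 0 τ k`, `g′ τ = Uτ s τ k − Uτ 0 τ k`, `|g′| ≤ μ·s·e^{…}` by the MVT in `σ`
  have hg' : ∀ τ ∈ Icc (0 : ℝ) t, |Uτ s τ k - Uτ 0 τ k| ≤ μ * s * Real.exp (-(θ * (d k + d' k))) := by
    intro τ hτ
    have h := abs_sub_le_of_abs_deriv_le (f := fun σ => Uτ σ τ k) (f' := fun σ => Uστ σ τ k) hs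
      (fun σ hσ => hUστ σ hσ τ hτ k) (fun σ hσ => bστ σ hσ τ hτ k)
    calc |Uτ s τ k - Uτ 0 τ k| ≤ μ * Real.exp (-(θ * (d k + d' k))) * s := h
      _ = μ * s * Real.exp (-(θ * (d k + d' k))) := by ring
  have hg : ∀ τ ∈ Icc (0 : ℝ) t, HasDerivAt (fun τ => U s τ k - U 0 τ k) (Uτ s τ k - Uτ 0 τ k) τ :=
    fun τ hτ => (hUτ s hss τ hτ k).sub (hUτ 0 h0s τ hτ k)
  have h := abs_sub_le_of_abs_deriv_le (f := fun τ => U s τ k - U 0 τ k) (f' := fun τ => Uτ s τ k - Uτ 0 τ k) ht hg hg'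
  calc |U s t k - U s 0 k - U 0 t k + U 0 0 k| = |(U s t k - U 0 t k) - (U s 0 k - U 0 0 k)| := by ring_nf
    _ ≤ μ * s * Real.exp (-(θ * (d k + d' k))) * t := h
    _ = μ * s * t * Real.exp (-(θ * (d k + d' k))) := by ring

end Literature.Analysis.Matrix

end
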